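import Mathlib
import HarnessLib
import Summits.Ventures.LatticeQCDFlow.Exactness.FlowSamplerKLFloor
import Summits.Ventures.LatticeQCDFlow.Scaling.AutoregressiveProposalKLPinsker

/-!
# LatticeQCDFlow / Scaling — an exact sampler driven by an autoregressive proposal pays
# `τ_int(sign) ≥ e^{KL} − ½ ≥ exp(½ Σ_k δ_k²) − ½` and keeps a Kish fraction `≤ e^{−KL} ≤ exp(−½ Σ_k δ_k²)`

HONEST FRAMING: exact (Metropolis-corrected) sampling algorithms for lattice gauge theory;
figures of merit are autocorrelation/cost numbers at stated couplings and volumes; no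
continuum-physics claim.

Venture `LatticeQCDFlow` (cell pub-lqcd), topic `Scaling`, FANOUT row 30 (lean-1, GEN-20) — OUR WORK on
THEORY-2.md §4 row C5: the bridge from the cell's autoregressive error currencies to the venture's two
figures of merit, general product spaces.  Assembled from `Scaling/AutoregressiveProposalKLPinsker`
(training loss `≥ ½Σ_kδ_k²`) and row 2's `Exactness/FlowSamplerKLFloor` / `IMHSignObservableSandwich`
(`1/κ ≥ e^{D(π‖q)}` and `τ_int(g) ≥ e^{D(π‖q)} − ½` for every balanced sign observable `g` of the exact
independence sampler with proposal density `q`; Chatterjee–Diaconis 2018 NAMED there).  The gauge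
assembly (exponential in the number of endpoint-blind links, hence in the volume) is
`Scaling/AutoregressiveGaugeSlowingDown` / `…KLExtensiveAnyOrder`.

## What is proved (all [ours]; assembled; `π = ⊗_ι μ`; weight `F` and conditionals `q_a` squeezed between
positive constants, `q_a` normalised in `a`; an autoregressive block `l`; the hybrid / model
`H_l = (∏_k q_{a_k})·A_{s_0}F/Z`)

* `integral_arHybrid_eq_one` (`H_l` is a probability density), `arHybrid_facts` (squeeze, integrability);
* **`arHybrid_exp_kl_le_invKish`** — `exp(KL(F/Z ‖ H_l)) ≤ W₂/Z²`, `W₂ = ∫ (F/H_l)·F dπ` the second moment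
  of the importance weights (`κ = Z²/W₂` the Kish fraction);
* **`arHybrid_exp_kl_le_tauInt_sign`** — for every measurable `g` with `g² = 1`, `∫ g F dπ = 0`:
  `exp(KL) − ½ ≤ τ_int(g)` for the exact sampler `imhOp π F H_l`;
* with `l` duplicate-free, **`arHybrid_invKish_ge_exp`**, **`arHybrid_tauInt_sign_ge_exp`**: the same with
  `KL` replaced by `Σ_k (∫|A_{s_k}F − q_{a_k}A_{s_{k−1}}F| dπ)²/(2Z²) = ½Σ_kδ_k²`.

READING (value-free): the integrated autocorrelation time of ANY balanced sign observable of an exact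
autoregressive / flow sampler is at least the exponential of its forward training loss (less ½), hence at
least `exp(½Σ_kδ_k²) − ½` in the conditional `L¹` errors of the acceptance form; the reweighting
estimator's effective sample size is at most `e^{−KL}` of the sample.  NOT CLAIMED: smooth observables;
the acceptance itself; the reverse relative entropy.  No `def`, no `sorry`, nothing cited as a fact.
-/

noncomputable section

namespace Summit.Ventures.LatticeQCDFlow.Theory2.Autoregressive

open MeasureTheory Function Set
open Summit.Ventures.LatticeQCDFlow.Exactness Summit.Ventures.LatticeQCDFlow.Scoring

/-! ## §1 General index set -/

section General

variable {ι : Type*} [Fintype ι] [DecidableEq ι] {X : Type*} [MeasurableSpace X]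
variable (μ : Measure X) [IsProbabilityMeasure μ]

/-- **The hybrid is a probability density**: `∫ (∏_k q_{a_k})·A_{s_0}F/Z dπ = 1` (the autoregressive
tail integrates away against `A_{s_0}F`, which is blind to the block). [ours] -/
theorem integral_arHybrid_eq_one {q : ι → (ι → X) → ℝ} (hqm : ∀ a, Measurable (q a))
    (hq0 : ∀ a ω, 0 ≤ q a ω) {Cq : ℝ} (hqb : ∀ a ω, q a ω ≤ Cq)
    (hq1 : ∀ a ω, ∫ v, q a (update ω a v) ∂μ = 1)
    {F : (ι → X) → ℝ} (hFm : Measurable F) {CF : ℝ} (hFb : ∀ ω, |F ω| ≤ CF)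
    (hZ : 0 < ∫ ω, F ω ∂Measure.pi (fun _ : ι => μ)) (l : List ι)
    (hpw : l.Pairwise (fun a b => ∀ ω v, q a (update ω b v) = q a ω)) :
    ∫ ω, (l.map fun b => q b ω).prod * coordAvg μ l.toFinset F ω / (∫ η, F η ∂Measure.pi (fun _ : ι => μ))
        ∂Measure.pi (fun _ : ι => μ) = 1 := by
  set Z : ℝ := ∫ η, F η ∂Measure.pi (fun _ : ι => μ) with hZdef
  have hAm : Measurable (coordAvg μ l.toFinset F) := measurable_coordAvg μ l.toFinset hFm
  have hAb : ∀ ω, |coordAvg μ l.toFinset F ω| ≤ CF := abs_coordAvg_le_of_abs_le μ l.toFinset hFm hFb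
  have hAl : ∀ b ∈ l, ∀ ω v, coordAvg μ l.toFinset F (update ω b v) = coordAvg μ l.toFinset F ω := by
    intro b hb ω v
    have e : update ω b v = l.toFinset.piecewise (update ω b v) ω := by
      ext i
      by_cases hil : i ∈ l.toFinset
      · rw [Finset.piecewise_eq_of_mem _ _ _ hil]
      · rw [Finset.piecewise_eq_of_notMem _ _ _ hil]
        have hi : i ≠ b := fun h => hil (by rw [h]; exact List.mem_toFinset.2 hb)
        rw [update_of_ne hi]
    rw [e, coordAvg_apply_piecewise]
  have htail := pi_integral_mul_arTail μ hqm hq0 hqb hq1 l hpw hAm hAb hAl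
  calc ∫ ω, (l.map fun b => q b ω).prod * coordAvg μ l.toFinset F ω / Z ∂Measure.pi (fun _ : ι => μ)
      = Z⁻¹ * ∫ ω, coordAvg μ l.toFinset F ω * (l.map fun b => q b ω).prod ∂Measure.pi (fun _ : ι => μ) := by
        rw [← integral_const_mul]
        refine integral_congr_ae (ae_of_all _ fun ω => ?_)
        dsimp only
        ring
    _ = Z⁻¹ * Z := by rw [htail, pi_integral_coordAvg μ l.toFinset hFm hFb]
    _ = 1 := inv_mul_cancel₀ hZ.ne'

/-- **Bookkeeping for the hybrid**: `Z > 0`; `H_l` is measurable, squeezed between positive constants, a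
probability density; the weight second moment `(F/H_l)·F` and the entropy integrand `F·log(F/(Z H_l))` are
integrable. [ours] -/
theorem arHybrid_facts {q : ι → (ι → X) → ℝ} (hqm : ∀ a, Measurable (q a))
    {cq Cq : ℝ} (hcq : 0 < cq) (hqlo : ∀ a ω, cq ≤ q a ω) (hqhi : ∀ a ω, q a ω ≤ Cq)
    (hq1 : ∀ a ω, ∫ v, q a (update ω a v) ∂μ = 1)
    {F : (ι → X) → ℝ} (hFm : Measurable F) {cF CF : ℝ} (hcF : 0 < cF) (hFlo : ∀ ω, cF ≤ F ω)
    (hFhi : ∀ ω, F ω ≤ CF) (l : List ι)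
    (hpw : l.Pairwise (fun a b => ∀ ω v, q a (update ω b v) = q a ω)) :
    0 < ∫ η, F η ∂Measure.pi (fun _ : ι => μ) ∧
    (∀ ω, 0 < (l.map fun b => q b ω).prod * coordAvg μ l.toFinset F ω / ∫ η, F η ∂Measure.pi (fun _ : ι => μ)) ∧
    (Measurable fun ω =>
      (l.map fun b => q b ω).prod * coordAvg μ l.toFinset F ω / ∫ η, F η ∂Measure.pi (fun _ : ι => μ)) ∧
    Integrable (fun ω =>
      (l.map fun b => q b ω).prod * coordAvg μ l.toFinset F ω / ∫ η, F η ∂Measure.pi (fun _ : ι => μ))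
      (Measure.pi fun _ : ι => μ) ∧
    ∫ ω, (l.map fun b => q b ω).prod * coordAvg μ l.toFinset F ω / (∫ η, F η ∂Measure.pi (fun _ : ι => μ))
        ∂Measure.pi (fun _ : ι => μ) = 1 ∧
    Integrable (fun ω => F ω /
        ((l.map fun b => q b ω).prod * coordAvg μ l.toFinset F ω / ∫ η, F η ∂Measure.pi (fun _ : ι => μ)) * F ω)
      (Measure.pi fun _ : ι => μ) ∧
    Integrable (fun ω => F ω * Real.log (F ω / ((∫ η, F η ∂Measure.pi (fun _ : ι => μ)) *
        ((l.map fun b => q b ω).prod * coordAvg μ l.toFinset F ω / ∫ η, F η ∂Measure.pi (fun _ : ι => μ)))))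
      (Measure.pi fun _ : ι => μ) := by
  set Z : ℝ := ∫ η, F η ∂Measure.pi (fun _ : ι => μ) with hZdef
  set H : (ι → X) → ℝ := fun ω => (l.map fun b => q b ω).prod * coordAvg μ l.toFinset F ω / Z with hH
  have hF0 : ∀ ω, 0 < F ω := fun ω => hcF.trans_le (hFlo ω)
  have hFabs : ∀ ω, |F ω| ≤ CF := fun ω => by rw [abs_of_pos (hF0 ω)]; exact hFhi ω
  have hq0 : ∀ a ω, 0 ≤ q a ω := fun a ω => hcq.le.trans (hqlo a ω)
  have hFi : Integrable F (Measure.pi fun _ : ι => μ) := integrable_pi_of_abs_le μ hFm hFabs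
  have hZpos : 0 < Z := by
    have h1 : ∫ _, cF ∂Measure.pi (fun _ : ι => μ) ≤ Z := integral_mono (integrable_const cF) hFi hFlo
    have h2 : ∫ _, cF ∂Measure.pi (fun _ : ι => μ) = cF := by
      rw [integral_const, smul_eq_mul, Measure.real, measure_univ, ENNReal.toReal_one, one_mul]
    linarith
  have ω₀ : ι → X := fun _ => (MeasureTheory.nonempty_of_isProbabilityMeasure μ).some
  have hPm : Measurable fun ω => (l.map fun b => q b ω).prod := by
    rcases le_or_gt 0 Cq with hCq | hCq
    · exact (arProd_props hqm hq0 hqhi hCq l).1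
    · cases l with
      | nil => simp
      | cons b _ => exact absurd (hqhi b ω₀) (not_le.2 (hCq.trans_le (hcq.le.trans (hqlo b ω₀))))
  have hPlo : ∀ ω, cq ^ l.length ≤ (l.map fun b => q b ω).prod := fun ω => (arProd_bounds hcq hqlo hqhi ω l).1
  have hPhi : ∀ ω, (l.map fun b => q b ω).prod ≤ Cq ^ l.length := fun ω => (arProd_bounds hcq hqlo hqhi ω l).2
  have hAf := fun ω => coordAvg_pos_of_le μ l.toFinset hFm hcF hFlo hFhi ω
  have hHm : Measurable H := (hPm.mul (measurable_coordAvg μ l.toFinset hFm)).div_const Z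
  have hlo_pos : 0 < cq ^ l.length * cF / Z := div_pos (mul_pos (pow_pos hcq _) hcF) hZpos
  have hHlo : ∀ ω, cq ^ l.length * cF / Z ≤ H ω := fun ω =>
    div_le_div_of_nonneg_right (mul_le_mul (hPlo ω) (hAf ω).2.1 hcF.le
      ((pow_pos hcq _).le.trans (hPlo ω))) hZpos.le
  have hH0 : ∀ ω, 0 < H ω := fun ω => hlo_pos.trans_le (hHlo ω)
  have hHhi : ∀ ω, H ω ≤ Cq ^ l.length * CF / Z := fun ω =>
    div_le_div_of_nonneg_right (mul_le_mul (hPhi ω) (hAf ω).2.2 (hAf ω).1.le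
      (((pow_pos hcq _).le.trans (hPlo ω)).trans (hPhi ω))) hZpos.le
  have hhi_pos : 0 < Cq ^ l.length * CF / Z := hlo_pos.trans_le ((hHlo (fun _ =>
    (MeasureTheory.nonempty_of_isProbabilityMeasure μ).some)).trans (hHhi _))
  have hHabs : ∀ ω, |H ω| ≤ Cq ^ l.length * CF / Z := fun ω => by rw [abs_of_pos (hH0 ω)]; exact hHhi ω
  have hHi : Integrable H (Measure.pi fun _ : ι => μ) := integrable_pi_of_abs_le μ hHm hHabs
  have hH1 : ∫ ω, H ω ∂Measure.pi (fun _ : ι => μ) = 1 :=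
    integral_arHybrid_eq_one μ hqm hq0 hqhi hq1 hFm hFabs hZpos l hpw
  have hW : Integrable (fun ω => F ω / H ω * F ω) (Measure.pi fun _ : ι => μ) := by
    refine integrable_pi_of_abs_le μ ((hFm.div hHm).mul hFm)
      (C := CF / (cq ^ l.length * cF / Z) * CF) (fun ω => ?_)
    rw [abs_mul, abs_of_pos (div_pos (hF0 ω) (hH0 ω)), abs_of_pos (hF0 ω)]
    exact mul_le_mul (div_le_div₀ ((hF0 ω).le.trans (hFhi ω)) (hFhi ω) hlo_pos (hHlo ω))
      (hFhi ω) (hF0 ω).le (div_nonneg ((hF0 ω).le.trans (hFhi ω)) hlo_pos.le)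
  have hratm : Measurable fun ω => F ω / (Z * H ω) := hFm.div (measurable_const.mul hHm)
  have hrat := fun ω => div_mem_bounds hcF (mul_pos hZpos hlo_pos) (hFlo ω) (hFhi ω)
      (mul_le_mul_of_nonneg_left (hHlo ω) hZpos.le) (mul_le_mul_of_nonneg_left (hHhi ω) hZpos.le)
  have hKLi : Integrable (fun ω => F ω * Real.log (F ω / (Z * H ω))) (Measure.pi fun _ : ι => μ) := by
    have h := integrable_weight_mul_log μ hFm hFabs 1 hratm (div_pos hcF (mul_pos hZpos hhi_pos))
      (fun ω => (hrat ω).1) (fun ω => (hrat ω).2)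
    simpa only [div_one] using h
  exact ⟨hZpos, hH0, hHm, hHi, hH1, hW, hKLi⟩

/-- **`exp(KL(F/Z ‖ H_l)) ≤ W₂/Z²`** — the inverse Kish fraction of the importance weights `F/H_l` is at
least the exponential of the forward relative entropy (row 2's `weightMoment_ge_exp_kl`, its side
conditions discharged for the hybrid). [ours] -/
theorem arHybrid_exp_kl_le_invKish {q : ι → (ι → X) → ℝ} (hqm : ∀ a, Measurable (q a))
    {cq Cq : ℝ} (hcq : 0 < cq) (hqlo : ∀ a ω, cq ≤ q a ω) (hqhi : ∀ a ω, q a ω ≤ Cq)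
    (hq1 : ∀ a ω, ∫ v, q a (update ω a v) ∂μ = 1)
    {F : (ι → X) → ℝ} (hFm : Measurable F) {cF CF : ℝ} (hcF : 0 < cF) (hFlo : ∀ ω, cF ≤ F ω)
    (hFhi : ∀ ω, F ω ≤ CF) (l : List ι)
    (hpw : l.Pairwise (fun a b => ∀ ω v, q a (update ω b v) = q a ω)) :
    Real.exp (∫ ω, F ω / (∫ η, F η ∂Measure.pi (fun _ : ι => μ)) *
        Real.log ((F ω / ∫ η, F η ∂Measure.pi (fun _ : ι => μ)) /
          ((l.map fun b => q b ω).prod * coordAvg μ l.toFinset F ω / ∫ η, F η ∂Measure.pi (fun _ : ι => μ)))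
        ∂Measure.pi (fun _ : ι => μ)) ≤
      (∫ ω, F ω / ((l.map fun b => q b ω).prod * coordAvg μ l.toFinset F ω /
            ∫ η, F η ∂Measure.pi (fun _ : ι => μ)) * F ω ∂Measure.pi (fun _ : ι => μ)) /
        (∫ ω, F ω ∂Measure.pi (fun _ : ι => μ)) ^ 2 := by
  obtain ⟨hZpos, hH0, hHm, hHi, hH1, hW, hKLi⟩ :=
    arHybrid_facts μ hqm hcq hqlo hqhi hq1 hFm hcF hFlo hFhi l hpw
  set Z : ℝ := ∫ η, F η ∂Measure.pi (fun _ : ι => μ) with hZdef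
  set H : (ι → X) → ℝ := fun ω => (l.map fun b => q b ω).prod * coordAvg μ l.toFinset F ω / Z with hH
  have hF0 : ∀ ω, 0 < F ω := fun ω => hcF.trans_le (hFlo ω)
  have hFi : Integrable F (Measure.pi fun _ : ι => μ) :=
    integrable_pi_of_abs_le μ hFm (fun ω => by rw [abs_of_pos (hF0 ω)]; exact hFhi ω)
  have hkl := weightMoment_ge_exp_kl (μ := Measure.pi fun _ : ι => μ) hF0 hFi hH0 hH1 hW hKLi
  have hD : (∫ ω, F ω * Real.log (F ω / (Z * H ω)) ∂Measure.pi (fun _ : ι => μ)) / Z =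
      ∫ ω, F ω / Z * Real.log ((F ω / Z) / H ω) ∂Measure.pi (fun _ : ι => μ) := by
    rw [div_eq_inv_mul, ← integral_const_mul]
    refine integral_congr_ae (ae_of_all _ fun ω => ?_)
    dsimp only
    rw [div_div]
    ring
  rw [hD] at hkl
  exact hkl

variable [SFinite (Measure.pi fun _ : ι => μ)] in
/-- **`exp(KL(F/Z ‖ H_l)) − ½ ≤ τ_int(g)`** for every measurable balanced sign observable `g` (`g² = 1`,
`∫ g F dπ = 0`) of the exact independence sampler with target `F/Z` and proposal `H_l` (row 2's
sign-observable sandwich, its side conditions discharged for the hybrid). [ours] -/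
theorem arHybrid_exp_kl_le_tauInt_sign {q : ι → (ι → X) → ℝ} (hqm : ∀ a, Measurable (q a))
    {cq Cq : ℝ} (hcq : 0 < cq) (hqlo : ∀ a ω, cq ≤ q a ω) (hqhi : ∀ a ω, q a ω ≤ Cq)
    (hq1 : ∀ a ω, ∫ v, q a (update ω a v) ∂μ = 1)
    {F : (ι → X) → ℝ} (hFm : Measurable F) {cF CF : ℝ} (hcF : 0 < cF) (hFlo : ∀ ω, cF ≤ F ω)
    (hFhi : ∀ ω, F ω ≤ CF) (l : List ι)
    (hpw : l.Pairwise (fun a b => ∀ ω v, q a (update ω b v) = q a ω))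
    {g : (ι → X) → ℝ} (hgm : Measurable g) (hg1 : ∀ ω, g ω ^ 2 = 1)
    (hg0 : ∫ ω, g ω * F ω ∂Measure.pi (fun _ : ι => μ) = 0) :
    Real.exp (∫ ω, F ω / (∫ η, F η ∂Measure.pi (fun _ : ι => μ)) *
        Real.log ((F ω / ∫ η, F η ∂Measure.pi (fun _ : ι => μ)) /
          ((l.map fun b => q b ω).prod * coordAvg μ l.toFinset F ω / ∫ η, F η ∂Measure.pi (fun _ : ι => μ)))
        ∂Measure.pi (fun _ : ι => μ)) - 1 / 2 ≤
      tauInt (fun k => (∫ ω, g ω * ((imhOp (Measure.pi fun _ : ι => μ) F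
          (fun ω => (l.map fun b => q b ω).prod * coordAvg μ l.toFinset F ω /
            ∫ η, F η ∂Measure.pi (fun _ : ι => μ)))^[k] g) ω * F ω ∂Measure.pi (fun _ : ι => μ)) /
          ∫ ω, g ω ^ 2 * F ω ∂Measure.pi (fun _ : ι => μ)) := by
  obtain ⟨hZpos, hH0, hHm, hHi, hH1, hW, hKLi⟩ :=
    arHybrid_facts μ hqm hcq hqlo hqhi hq1 hFm hcF hFlo hFhi l hpw
  have hF0 : ∀ ω, 0 < F ω := fun ω => hcF.trans_le (hFlo ω)
  have hFi : Integrable F (Measure.pi fun _ : ι => μ) :=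
    integrable_pi_of_abs_le μ hFm (fun ω => by rw [abs_of_pos (hF0 ω)]; exact hFhi ω)
  obtain ⟨hlow, -⟩ := imhOp_sign_tauInt_sandwich (μ := Measure.pi fun _ : ι => μ) hF0 hFm hFi hH0 hHm
    hHi hH1 hW hgm hg1 hg0
  have hexp := arHybrid_exp_kl_le_invKish μ hqm hcq hqlo hqhi hq1 hFm hcF hFlo hFhi l hpw
  exact le_trans (sub_le_sub_right hexp _) hlow

/-- **`1/κ ≥ exp(½ Σ_k δ_k²)`** (`l` duplicate-free): the inverse Kish fraction of the hybrid's
importance weights is at least `exp(Σ_k (∫|A_{s_k}F − q_{a_k}A_{s_{k−1}}F| dπ)²/(2Z²))`. [ours] -/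
theorem arHybrid_invKish_ge_exp {q : ι → (ι → X) → ℝ} (hqm : ∀ a, Measurable (q a))
    {cq Cq : ℝ} (hcq : 0 < cq) (hqlo : ∀ a ω, cq ≤ q a ω) (hqhi : ∀ a ω, q a ω ≤ Cq)
    (hq1 : ∀ a ω, ∫ v, q a (update ω a v) ∂μ = 1)
    {F : (ι → X) → ℝ} (hFm : Measurable F) {cF CF : ℝ} (hcF : 0 < cF) (hFlo : ∀ ω, cF ≤ F ω)
    (hFhi : ∀ ω, F ω ≤ CF) (l : List ι) (hl : l.Nodup)
    (hpw : l.Pairwise (fun a b => ∀ ω v, q a (update ω b v) = q a ω)) :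
    Real.exp (((l.zip l.tails.tail).map fun c : ι × List ι =>
        (∫ ω, |coordAvg μ c.2.toFinset F ω - q c.1 ω * coordAvg μ (c.1 :: c.2).toFinset F ω|
          ∂Measure.pi (fun _ : ι => μ)) ^ 2).sum / (2 * (∫ ω, F ω ∂Measure.pi (fun _ : ι => μ)) ^ 2)) ≤
      (∫ ω, F ω / ((l.map fun b => q b ω).prod * coordAvg μ l.toFinset F ω /
            ∫ η, F η ∂Measure.pi (fun _ : ι => μ)) * F ω ∂Measure.pi (fun _ : ι => μ)) /
        (∫ ω, F ω ∂Measure.pi (fun _ : ι => μ)) ^ 2 := by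
  obtain ⟨hZpos, -⟩ := arHybrid_facts μ hqm hcq hqlo hqhi hq1 hFm hcF hFlo hFhi l hpw
  have hsum := sum_sq_condGap_le_two_mul_kl μ hqm hcq hqlo hqhi hq1 hFm hcF hFlo hFhi l hl hpw
  refine (Real.exp_le_exp.2 ?_).trans (arHybrid_exp_kl_le_invKish μ hqm hcq hqlo hqhi hq1 hFm hcF hFlo
    hFhi l hpw)
  rw [div_le_iff₀ (by positivity)]
  calc _ ≤ _ := hsum
    _ = _ := by ring

variable [SFinite (Measure.pi fun _ : ι => μ)] in
/-- **`τ_int(sign) ≥ exp(½ Σ_k δ_k²) − ½`** (`l` duplicate-free), for every measurable balanced sign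
observable of the exact sampler driven by the hybrid. [ours] -/
theorem arHybrid_tauInt_sign_ge_exp {q : ι → (ι → X) → ℝ} (hqm : ∀ a, Measurable (q a))
    {cq Cq : ℝ} (hcq : 0 < cq) (hqlo : ∀ a ω, cq ≤ q a ω) (hqhi : ∀ a ω, q a ω ≤ Cq)
    (hq1 : ∀ a ω, ∫ v, q a (update ω a v) ∂μ = 1)
    {F : (ι → X) → ℝ} (hFm : Measurable F) {cF CF : ℝ} (hcF : 0 < cF) (hFlo : ∀ ω, cF ≤ F ω)
    (hFhi : ∀ ω, F ω ≤ CF) (l : List ι) (hl : l.Nodup)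
    (hpw : l.Pairwise (fun a b => ∀ ω v, q a (update ω b v) = q a ω))
    {g : (ι → X) → ℝ} (hgm : Measurable g) (hg1 : ∀ ω, g ω ^ 2 = 1)
    (hg0 : ∫ ω, g ω * F ω ∂Measure.pi (fun _ : ι => μ) = 0) :
    Real.exp (((l.zip l.tails.tail).map fun c : ι × List ι =>
        (∫ ω, |coordAvg μ c.2.toFinset F ω - q c.1 ω * coordAvg μ (c.1 :: c.2).toFinset F ω|
          ∂Measure.pi (fun _ : ι => μ)) ^ 2).sum / (2 * (∫ ω, F ω ∂Measure.pi (fun _ : ι => μ)) ^ 2))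
        - 1 / 2 ≤
      tauInt (fun k => (∫ ω, g ω * ((imhOp (Measure.pi fun _ : ι => μ) F
          (fun ω => (l.map fun b => q b ω).prod * coordAvg μ l.toFinset F ω /
            ∫ η, F η ∂Measure.pi (fun _ : ι => μ)))^[k] g) ω * F ω ∂Measure.pi (fun _ : ι => μ)) /
          ∫ ω, g ω ^ 2 * F ω ∂Measure.pi (fun _ : ι => μ)) := by
  obtain ⟨hZpos, -⟩ := arHybrid_facts μ hqm hcq hqlo hqhi hq1 hFm hcF hFlo hFhi l hpw
  have hsum := sum_sq_condGap_le_two_mul_kl μ hqm hcq hqlo hqhi hq1 hFm hcF hFlo hFhi l hl hpw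
  refine le_trans (sub_le_sub_right (Real.exp_le_exp.2 ?_) _)
    (arHybrid_exp_kl_le_tauInt_sign μ hqm hcq hqlo hqhi hq1 hFm hcF hFlo hFhi l hpw hgm hg1 hg0)
  rw [div_le_iff₀ (by positivity)]
  calc _ ≤ _ := hsum
    _ = _ := by ring

end General

end Summit.Ventures.LatticeQCDFlow.Theory2.Autoregressive

end
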